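import Summits.MatrixMultiplication.MatrixMultiplication.Theses.MarginalColumns
import Literature.Computability.AlgebraicComplexity.BorderRankMatMulRectangular

/-!
# Birth skeleton (BC3) for crux `SecondColumnCheap` (C) — stmt-MatrixMultiplication-16309

Route `route-MatrixMultiplication-MarginalColumns` (rank-2 crux).  The crux, with
`T(a,b) := bR⟨a,b,2⟩ = algBorderRank (matMulTensor ℂ a b 2)` (an `a × b` matrix times a `b × 2` one):

  `C : ∀ ε > 0, ∃ C, ∀ n ≥ 1, T(n,n) ≤ n² + C·n^{1+ε}`   (the second column of the square tower costs `n^{1+o(1)}`).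

LINE `birth` — THE ROUTE'S OWN TRANSFER, ONE FORMAT DOWN.  Read `T(n,n)` not as the second column of
the square tower `w ↦ bR⟨n,n,w⟩` but as the top of the ROW TOWER of the thin format,
`a ↦ T(a,n) = bR⟨a,n,2⟩`, `a = 1, …, n` (an `a × n` matrix times an `n × 2` one).  Its first floor is
exact, `T(1,n) = 2n` (flattening, tree), and its FIRST MARGINAL `T(2,n) − T(1,n)` is the SIBLING
tower of the route header: `T(2,n) = bR⟨2,n,2⟩ = bR⟨n,2,2⟩` (cyclic symmetry, tree), printed window
`3n ≤ bR⟨n,2,2⟩ ≤ 3n + ⌈n/7⌉` (LandsbergRyder2015 §3; Smirnov2015), expected `3n + 1`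
(LandsbergGCT2017 §4.8.2; = `HollowSchoolbook.TowerTwoTwo`).  The hollow-schoolbook law
`T(a,b) = ab + a + b − 1` is AFFINE in `a`: every later row costs exactly the first marginal `b + 1`.
So C follows from the two invariants of marginal economy stated for THIS tower, each with
`n^{o(1)}` slack (the weakest form the assembly tolerates):
* `stub_twoTowerSubaffine` — the sibling tower is subaffine, `bR⟨n,2,2⟩ ≤ 3n + L_θ n^θ` for every
  `θ > 0` (the first marginal of the row tower is `n + n^{o(1)}`);
* `stub_firstRowDearest` — in the row tower no later row costs more than the first one, up to
  `L_θ (a+b)^θ`: `T(a+1,b) + T(1,b) ≤ T(a,b) + T(2,b) + L_θ (a+b)^θ` (the analogue, for the base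
  `(b,2)`, of the route's crux D = `SecondColumnDominates` for the base `(n,n)`; law-exact with slack 0).
ASSEMBLY (`SecondColumnCheap_of`, sorry-free): induction on `a` gives
`T(a+1,n) + a·T(1,n) ≤ T(1,n) + a·T(2,n) + a·L(a+1+n)^θ`; at `a = n − 1`, with `T(1,n) ≥ 2n`
(coefficient `1 − a ≤ 0`) and `T(2,n) ≤ 3n + L' n^θ`:
`T(n,n) ≤ n² + n + (n−1)(L' n^θ + L (2n)^θ) ≤ n² + (1 + L' + 2^θ L)·n^{1+θ}`; take `θ = ε`.
Neither stub alone gives C: the first speaks of `⟨n,2,2⟩` only; the second with the tree's / printed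
bound `T(2,n) ≤ 3.5n` / `3n + ⌈n/7⌉` yields only `T(n,n) ≤ (3/2)n²` / `(8/7)n²`.

DISPROOF USED: none — no `Disproof.lean` is registered for this crux (`ledger crux ls
stmt-MatrixMultiplication-16309`: no workfiles, 2026-08-17).  Negatives index (8 refuted statements,
all STPP/design side): untouched.  Dead lines: none recorded.
BARRIERS: as the route (technique_class border-rank-small-formats / format-induction):
InfimumNotMinimum respected (no single format certifies an exponent; the stubs are all-`n` tower
statements with slack), Irreversibility / UniversalMethod / UnstableTensor / Rectangular not in class
(no fixed carrier tensor, no laser method), LinearRankMethod relevant only to refuting the stubs and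
no obstruction there (the decisive cells `bR⟨n,2,2⟩ − 3n`, `T(a+1,b) − T(a,b)` are linear-size).
-/

set_option linter.dupNamespace false

namespace Summit.MatrixMultiplication.MatrixMultiplication.Cruxes.SecondColumnCheap.Birth

open Literature.Computability.AlgebraicComplexity

/-! ## Stub signatures (named, so that the composition `SecondColumnCheap_of` takes them BY NAME) -/

/-- Signature of STUB 1 (`stub_twoTowerSubaffine`): the sibling tower is subaffine,
`∀ θ > 0 ∃ L ∀ n ≥ 1, bR⟨n,2,2⟩ ≤ 3n + L·n^θ`. -/
abbrev Sig.stub_twoTowerSubaffine : Prop :=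
  ∀ θ : ℝ, 0 < θ → ∃ L : ℝ, ∀ n : ℕ, 1 ≤ n →
    (algBorderRank (matMulTensor ℂ n 2 2) : ℝ) ≤ 3 * (n : ℝ) + L * (n : ℝ) ^ θ

/-- Signature of STUB 2 (`stub_firstRowDearest`): in the row tower `a ↦ bR⟨a,b,2⟩` the first row is
the dearest, `∀ θ > 0 ∃ L ∀ a b ≥ 1, bR⟨a+1,b,2⟩ + bR⟨1,b,2⟩ ≤ bR⟨a,b,2⟩ + bR⟨2,b,2⟩ + L·(a+b)^θ`. -/
abbrev Sig.stub_firstRowDearest : Prop :=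
  ∀ θ : ℝ, 0 < θ → ∃ L : ℝ, ∀ a b : ℕ, 1 ≤ a → 1 ≤ b →
    (algBorderRank (matMulTensor ℂ (a + 1) b 2) : ℝ) +
        (algBorderRank (matMulTensor ℂ 1 b 2) : ℝ) ≤
      (algBorderRank (matMulTensor ℂ a b 2) : ℝ) +
        (algBorderRank (matMulTensor ℂ 2 b 2) : ℝ) + L * ((a : ℝ) + (b : ℝ)) ^ θ

/-! ## The stubs (the only `sorry`s of the file) -/

/-- **Stub 1 (the sibling tower is subaffine).**  For every `θ > 0` there is `L` with
`bR⟨n,2,2⟩ ≤ 3n + L·n^θ` for all `n ≥ 1` (format `matMulTensor ℂ n 2 2`: an `n × 2` matrix times a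
`2 × 2` one; `= bR⟨2,n,2⟩ = bR⟨2,2,n⟩` by cyclic symmetry).  Printed: `3n ≤ bR⟨n,2,2⟩ ≤ 3n + ⌈n/7⌉`
(LandsbergRyder2015 §3 summary display, tree fact `LandsbergRyder2017_borderRank_matMulTensor_n22_window`;
gluing of the reduced tensors of BCLR 1979 (`5`), Alekseev–Smirnov 2013 (`8`), Smirnov 2015
(`⟨7,2,2⟩ ≤ 22`) by LandsbergRyder2015 Prop. 3.1); expected `3n + 1` for all `n` (LandsbergGCT2017
§4.8.2, ConnerHarperLandsberg2023 p. 4), which gives the stub with `L = 1` for every `θ`.  OPEN exactly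
in the gap between `⌈n/7⌉` and `n^{o(1)}`: it needs reduced tensors `M^red_⟨m,2,2⟩` of border rank
`3m − 1 + o(m)` for unboundedly many `m` (printed only `m ≤ 3`), or another gluing. -/
theorem stub_twoTowerSubaffine :
    ∀ θ : ℝ, 0 < θ → ∃ L : ℝ, ∀ n : ℕ, 1 ≤ n →
      (algBorderRank (matMulTensor ℂ n 2 2) : ℝ) ≤ 3 * (n : ℝ) + L * (n : ℝ) ^ θ := by
  sorry

/-- **Stub 2 (in the row tower of the thin format the first row is the dearest, up to `(a+b)^θ`).**
For every `θ > 0` there is `L` with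
`bR⟨a+1,b,2⟩ + bR⟨1,b,2⟩ ≤ bR⟨a,b,2⟩ + bR⟨2,b,2⟩ + L·(a+b)^θ` for all `a, b ≥ 1`: the marginal cost of
the `(a+1)`-st row of `A` in `(a × b)·(b × 2)` is at most the first marginal `bR⟨2,b,2⟩ − 2b`
(`= b + 1` expected), up to `n^{o(1)}` — diminishing returns along `a ↦ bR⟨a,b,2⟩`, the
subtraction-free shadow of concavity, exactly as the route's `SecondColumnDominates` is for
`w ↦ bR⟨n,n,w⟩`.  Law-exact (slack `0`) under the hollow-schoolbook law `bR⟨a,b,2⟩ = ab + a + b − 1`;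
consistent with every known cell: `(a,b) = (2,2)`: `10 + 4 = 7 + 7`; `(3,2), (4,2)`: `13 + 4 ≤ 10 + 7`,
`16 + 4 ≤ 13 + 7` (BCLR/Alekseev–Smirnov gluings); `(2,3)`: `14 + 6 = 10 + 10` (CHL 2023 Thm 1.4(1),
BCLR `⟨2,3,2⟩ = 10`) — tight twice.  First open cells of the slack-0 form: `bR⟨4,3,2⟩ ≤ 18`,
`bR⟨4,4,2⟩ ≤ 23` (`= HollowSchoolbook.FourFourTwo`; printed window `[22, 24]`), `bR⟨8,2,2⟩ ≤ 25`.
Why it might fail: marginals of RANK towers are not monotone (`R⟨2,2,w⟩ = 4, 7, 11`), only border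
rank is expected to be; a border-apolarity bound `bR⟨2,n,n⟩ ≥ (1+c)n²` (route support
`SecondColumnGrowth`) kills it together with C. -/
theorem stub_firstRowDearest :
    ∀ θ : ℝ, 0 < θ → ∃ L : ℝ, ∀ a b : ℕ, 1 ≤ a → 1 ≤ b →
      (algBorderRank (matMulTensor ℂ (a + 1) b 2) : ℝ) +
          (algBorderRank (matMulTensor ℂ 1 b 2) : ℝ) ≤
        (algBorderRank (matMulTensor ℂ a b 2) : ℝ) +
          (algBorderRank (matMulTensor ℂ 2 b 2) : ℝ) + L * ((a : ℝ) + (b : ℝ)) ^ θ := by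
  sorry

/-! ## Assembly (sorry-free) -/

/-- **Assembly**: the two stub signatures (BY NAME: `Sig.stub_twoTowerSubaffine`, `Sig.stub_firstRowDearest`)
imply the crux `MarginalColumns.SecondColumnCheap` BY NAME.
Row induction in the thin tower `a ↦ bR⟨a,n,2⟩`, the flattening value `bR⟨1,n,2⟩ ≥ 2n`
(`mul_le_algBorderRank_matMulTensor_right`), the cyclic symmetry `bR⟨2,n,2⟩ = bR⟨n,2,2⟩`
(`algBorderRank_matMulTensor_rotate`), and `rpow` bookkeeping (`θ := ε`,
`C := 1 + L₁⁺ + 2^ε L₂⁺`). -/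
theorem SecondColumnCheap_of :
    Sig.stub_twoTowerSubaffine → Sig.stub_firstRowDearest →
      Summit.MatrixMultiplication.MatrixMultiplication.Theses.MarginalColumns.SecondColumnCheap := by
  intro h1 h2 ε hε
  obtain ⟨L₁, hL₁⟩ := h1 ε hε
  obtain ⟨L₂, hL₂⟩ := h2 ε hε
  -- Nonnegative majorants of the two slack constants.
  set M₁ : ℝ := max L₁ 0 with hM₁
  set M₂ : ℝ := max L₂ 0 with hM₂
  have hM₁0 : 0 ≤ M₁ := le_max_right _ _
  have hM₂0 : 0 ≤ M₂ := le_max_right _ _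
  have h2ε : (0 : ℝ) < (2 : ℝ) ^ ε := Real.rpow_pos_of_pos two_pos ε
  refine ⟨1 + M₁ + (2 : ℝ) ^ ε * M₂, ?_⟩
  intro n hn
  have hn0 : (0 : ℝ) < n := by exact_mod_cast (show 0 < n by omega)
  have hn1 : (1 : ℝ) ≤ n := by exact_mod_cast hn
  -- Step A (row induction in the thin tower a ↦ T(a,n), b = n fixed):
  --   T(a+1,n) + a·T(1,n) ≤ T(1,n) + a·T(2,n) + a·M₂·(a+1+n)^ε.
  have rowInd : ∀ a : ℕ,
      (algBorderRank (matMulTensor ℂ (a + 1) n 2) : ℝ) +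
          (a : ℝ) * (algBorderRank (matMulTensor ℂ 1 n 2) : ℝ) ≤
        (algBorderRank (matMulTensor ℂ 1 n 2) : ℝ) +
          (a : ℝ) * (algBorderRank (matMulTensor ℂ 2 n 2) : ℝ) +
            (a : ℝ) * (M₂ * ((a : ℝ) + 1 + (n : ℝ)) ^ ε) := by
    intro a
    induction a with
    | zero => simp
    | succ a ih =>
      have step := hL₂ (a + 1) n (by omega) hn
      have hbase0 : (0 : ℝ) ≤ (a : ℝ) + 1 + n := by positivity
      have hpow0 : 0 ≤ ((a : ℝ) + 1 + n) ^ ε := Real.rpow_nonneg hbase0 ε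
      have hcast : (((a + 1 : ℕ) : ℝ) + (n : ℝ)) = (a : ℝ) + 1 + n := by push_cast; ring
      have hslack : L₂ * (((a + 1 : ℕ) : ℝ) + (n : ℝ)) ^ ε ≤ M₂ * ((a : ℝ) + 1 + n) ^ ε := by
        rw [hcast]
        exact mul_le_mul_of_nonneg_right (le_max_left _ _) hpow0
      have hmono : ((a : ℝ) + 1 + n) ^ ε ≤ ((a : ℝ) + 1 + 1 + n) ^ ε :=
        Real.rpow_le_rpow hbase0 (by linarith) hε.le
      have hM₂mono : M₂ * ((a : ℝ) + 1 + n) ^ ε ≤ M₂ * ((a : ℝ) + 1 + 1 + n) ^ ε :=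
        mul_le_mul_of_nonneg_left hmono hM₂0
      have haM₂mono : (a : ℝ) * (M₂ * ((a : ℝ) + 1 + n) ^ ε) ≤
          (a : ℝ) * (M₂ * ((a : ℝ) + 1 + 1 + n) ^ ε) :=
        mul_le_mul_of_nonneg_left hM₂mono (Nat.cast_nonneg a)
      have step' : (algBorderRank (matMulTensor ℂ (a + 1 + 1) n 2) : ℝ) +
            (algBorderRank (matMulTensor ℂ 1 n 2) : ℝ) ≤
          (algBorderRank (matMulTensor ℂ (a + 1) n 2) : ℝ) +
            (algBorderRank (matMulTensor ℂ 2 n 2) : ℝ) + M₂ * ((a : ℝ) + 1 + n) ^ ε := by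
        linarith [step, hslack]
      push_cast
      nlinarith [ih, step', hM₂mono, haM₂mono, hpow0, hM₂0, Nat.cast_nonneg (α := ℝ) a]
  -- The case n = 1: T(1,1) ≤ 2 ≤ 1 + C (standard algorithm).
  rcases Nat.lt_or_ge n 2 with hlt | hge
  · interval_cases n
    have hstd1 : (algBorderRank (matMulTensor ℂ 1 1 2) : ℝ) ≤ 1 * 1 * 2 := by
      exact_mod_cast (algBorderRank_le_tensorRank _).trans (tensorRank_matMulTensor_le ℂ 1 1 2)
    have hC0 : (0 : ℝ) ≤ M₁ + (2 : ℝ) ^ ε * M₂ := by positivity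
    simp only [Nat.cast_one, Real.one_rpow, one_pow]
    linarith
  -- Step B (n ≥ 2): specialise the row induction at a = n - 1 =: m ≥ 1.
  obtain ⟨m, rfl⟩ : ∃ m : ℕ, n = m + 1 := ⟨n - 1, by omega⟩
  have hmpos : 1 ≤ m := by omega
  have hrow := rowInd m
  -- Tree facts: the first floor T(1,n) ≥ 2n (flattening) and the first marginal via the sibling
  -- tower, T(2,n) = bR⟨2,n,2⟩ = bR⟨n,2,2⟩ ≤ 3n + M₁ n^ε (cyclic symmetry + stub 1).
  have hflat : ((m + 1 : ℕ) : ℝ) * 2 ≤ (algBorderRank (matMulTensor ℂ 1 (m + 1) 2) : ℝ) := by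
    exact_mod_cast mul_le_algBorderRank_matMulTensor_right ℂ 1 (m + 1) 2
  have hsib : (algBorderRank (matMulTensor ℂ 2 (m + 1) 2) : ℝ) ≤
      3 * ((m + 1 : ℕ) : ℝ) + M₁ * ((m + 1 : ℕ) : ℝ) ^ ε := by
    rw [algBorderRank_matMulTensor_rotate ℂ 2 (m + 1) 2]
    have h := hL₁ (m + 1) hn
    have hp0 : 0 ≤ ((m + 1 : ℕ) : ℝ) ^ ε := Real.rpow_nonneg (Nat.cast_nonneg _) ε
    have : L₁ * ((m + 1 : ℕ) : ℝ) ^ ε ≤ M₁ * ((m + 1 : ℕ) : ℝ) ^ ε :=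
      mul_le_mul_of_nonneg_right (le_max_left _ _) hp0
    linarith
  -- Step C: rpow bookkeeping at x := n = m + 1.
  set x : ℝ := ((m + 1 : ℕ) : ℝ) with hx
  have hx1 : (1 : ℝ) ≤ x := hn1
  have hx0 : (0 : ℝ) < x := hn0
  have hxm : x = (m : ℝ) + 1 := by rw [hx]; push_cast; ring
  have hxε0 : 0 ≤ x ^ ε := Real.rpow_nonneg hx0.le ε
  have hsplit : x ^ (1 + ε) = x * x ^ ε := by
    rw [Real.rpow_add hx0, Real.rpow_one]
  have hxle : x ≤ x ^ (1 + ε) := by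
    have h := Real.rpow_le_rpow_of_exponent_le hx1 (show (1 : ℝ) ≤ 1 + ε by linarith)
    rwa [Real.rpow_one] at h
  have htwo : ((m : ℝ) + 1 + x) ^ ε = (2 : ℝ) ^ ε * x ^ ε := by
    rw [← hxm, show x + x = 2 * x by ring, Real.mul_rpow (by norm_num) hx0.le]
  have hsq : x ^ (2 : ℕ) = x * x := sq x
  -- The main estimate (coefficient 1 - m ≤ 0 on T(1,n), m ≥ 0 on T(2,n)).
  have hm1 : (1 : ℝ) ≤ m := by exact_mod_cast hmpos
  have hT1 : (1 - (m : ℝ)) * (algBorderRank (matMulTensor ℂ 1 (m + 1) 2) : ℝ) ≤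
      (1 - (m : ℝ)) * (x * 2) :=
    mul_le_mul_of_nonpos_left hflat (by linarith)
  have hT2 : (m : ℝ) * (algBorderRank (matMulTensor ℂ 2 (m + 1) 2) : ℝ) ≤
      (m : ℝ) * (3 * x + M₁ * x ^ ε) :=
    mul_le_mul_of_nonneg_left hsib (by linarith)
  have hslack : (m : ℝ) * (M₂ * ((m : ℝ) + 1 + x) ^ ε) = (m : ℝ) * M₂ * (2 : ℝ) ^ ε * x ^ ε := by
    rw [htwo]; ring
  have hmx : (m : ℝ) ≤ x := by linarith
  have key : (algBorderRank (matMulTensor ℂ (m + 1) (m + 1) 2) : ℝ) ≤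
      x * x + x + (M₁ + (2 : ℝ) ^ ε * M₂) * (x * x ^ ε) := by
    have e1 : (m : ℝ) * (M₁ * x ^ ε) ≤ x * (M₁ * x ^ ε) :=
      mul_le_mul_of_nonneg_right hmx (mul_nonneg hM₁0 hxε0)
    have e2 : (m : ℝ) * (M₂ * (2 : ℝ) ^ ε * x ^ ε) ≤ x * (M₂ * (2 : ℝ) ^ ε * x ^ ε) :=
      mul_le_mul_of_nonneg_right hmx (mul_nonneg (mul_nonneg hM₂0 h2ε.le) hxε0)
    nlinarith [hrow, hT1, hT2, hslack, e1, e2, hxm]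
  show (algBorderRank (matMulTensor ℂ (m + 1) (m + 1) 2) : ℝ) ≤
    x ^ 2 + (1 + M₁ + (2 : ℝ) ^ ε * M₂) * x ^ (1 + ε)
  rw [hsq, hsplit]
  nlinarith [key, hxle, hsplit, hM₁0, hM₂0, h2ε.le, hxε0, hx0.le]

/-- **Registered skeleton conclusion** (h21 skeleton format `<Crux>_proof`): the crux BY NAME from
the two stubs.  The only `sorry`s of the file sit inside `stub_twoTowerSubaffine` and
`stub_firstRowDearest`. -/
theorem SecondColumnCheap_proof :
    Summit.MatrixMultiplication.MatrixMultiplication.Theses.MarginalColumns.SecondColumnCheap :=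
  SecondColumnCheap_of stub_twoTowerSubaffine stub_firstRowDearest

end Summit.MatrixMultiplication.MatrixMultiplication.Cruxes.SecondColumnCheap.Birth
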